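import Literature.NumberTheory.EllipticCurves.CongruenceNumber
import Literature.NumberTheory.EllipticCurves.GlobalMinimalModel
import Literature.NumberTheory.EllipticCurves.GaloisAction
import Literature.NumberTheory.EllipticCurves.QuadraticTwist
import Literature.NumberTheory.EllipticCurves.Isogeny
import Literature.NumberTheory.DiophantineGeometry.Conductor
import Literature.NumberTheory.DiophantineGeometry.TateAlgorithm
import Literature.NumberTheory.DiophantineGeometry.KodairaSymbol
import Mathlib.NumberTheory.Padics.HeightOneSpectrum
import HarnessLib
import HarnessLib.Audit.Tags

/-!
# Candidates E-desc-19, 19♯, 20, 21 of cell `bsd-f2-manin` (D-0131 (3) frontier: the Manin constant at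
# additive primes): the CONGRUENCE-EXCESS CEILING after the cell's finding F-desc-ARS — `@[conjecture]`
# leaves (NOTHING asserted; definitions only; proved placement edges, including the refutation of the
# Agashe–Ribet–Stein ceiling modulo one witness datum, live in the sibling `CongruenceExcessCeilingLawsEdges.lean`).

HONEST FRAMING. LENS = descent / visibility (planner `bsd-f2-manin-desc` g2 addendum 2026-08-27T21:42Z, HOME
`run/shared/lean/pub/bsd-f2-manin/MEMO-desc.md` §19.9; decls VERBATIM from HOME `desc/Sketch-desc-g2.lean` sha16
5680280cec81f6ef :234–:331, farm rc 0 · 0 warnings · 0 sorries, with the helper `kodairaAtPrime W 2 _` INLINED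
as `W.kodairaSymbolAt ((Rat.HeightOneSpectrum.primesEquiv (R := ℤ)).symm ⟨2, Nat.prime_two⟩)`). Notation as in
`CongruenceExcessLaws.lean`: `r_E = congruenceNumber f`, `m_E = D.modularDegree`, `x_p = ord_p(r_E) − ord_p(m_E)`.

THE FINDING F-desc-ARS (a certified finite computation against a printed conjecture; THREE engines; refuter-2
v7 §K⁷ FINAL PLACEMENT 2026-08-27T22:17Z: «REFUTED — BEYOND PRINT», no recorded counterexample or later
verification in print): Agashe–Ribet–Stein 2012 Conj. 2.2 «`ord_p(r_E/m_E) ≤ ½ ord_p(N)` for every optimal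
`E` and every prime `p`» (verified by its authors for `N ≤ 557`; tree `@[conjecture]`
`Literature.NumberTheory.EllipticCurves.ModularForms.AgasheRibetStein2012_conjecture`) FAILS on exactly 26
optimal curves in the cell's census v1.1 (HOME `desc/congr-census-v1.1.tsv` 4393f8fd4ada45b2: ALL 637
non-squarefree `N ≤ 2000` + 11 deeper levels, 4555 `(class, p)` incidences; 4549/4555 for ARS's `⌊v/2⌋`):
`(v₂(N), Kodaira type at 2, E[2]) = (7, II, irreducible)`, `x₂ = 4 > 7/2` — 1664 b1 f1 j1 o1 (`r_E = 1536 =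
2⁹·3`, `m_E = 96`), 1664 i1 t1 (2560, 160), 2432 a1 c1 (2560, 160), 2432 e1 g1 (4608, 288), 3200 c1 s1 (7680,
96), 3200 l1 z1 (7680, 480), 3200 k1 w1 (53760, 3360), 3200 n1 bb1 (53760, 672), 3456 a1 e1 (4608, 96), 3456 i1
n1 (4608, 288), 3456 j1 p1 (23040, 480), 3456 d1 g1 (23040, 1440); engines: (1) planner PARI `mf` (kit j285284 /
j290782 / j290784 / j290786) + certificate j289999 at 1664; (2) Sage modular symbols; (3) refuter-1's INDEPENDENT
cold re-derivation (§R32, REFUTER-ref1.md 610510c23506013d; PARI/GP HOME `ref1/W50-rE_engine-v1-j291761.gp`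
4e0eff115b852057, Atkin–Lehner assembly of `S₂(Γ₀(N),ℚ)`, `ℤ`-saturation, `r_E` by ARS p. 3 def (ii), `m_E =
ellmoddegree` = Cremona; calibration ARS Table 1 6/6; AT THE PAGE ARS 2012 p. 4 L92–104): 26/26 `(r_E, m_E)` to the
digit (HOME `ref1/W50-rE-mirror-v1.tsv` b3d4f1d10ecd5a00), every excess `= 4 = ⌈7/2⌉`, the 46 other optimal curves
at these four levels have `x₂ = 3`; director-bsd W-50 (2): VERDICT PASS. Lean currency: the refutation of the
tree's `AgasheRibetStein2012_conjecture` is a NEGATIVE LEMMA MODULO one datum —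
`not_agasheRibetStein2012_conjecture_of_typeTwo (h : DyadicTypeTwoExcessFour) (hw : TypeTwoSevenWitnessExists)`
in the sibling file (a `ModularParametrizationData` term for 1664b1 = modularity as data, not in the tree).
Manin's conjecture is untouched (`c = 1` on all 26, Cremona); the finding is peripheral to the route crux C2
`ManinOddAtFour` (stmt-BirchSwinnertonDyer-22967: a METHOD budget `x₂ = 4` at `v₂(N) = 7` for any
congruence-module road to `2 ∤ c`).

REF1 (R-desc-6, §R32 2026-08-27T22:14Z, CANDIDATES 42c55d7bde8084c0): E-desc-19 SURVIVES (78/78 rows at the four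
levels satisfy `⌈v_p N/2⌉`, equality also at `(5, 2)` on 3200) · E-desc-20 SURVIVES (χ₋₁-partner pairs 36/36 equal
`r_E`; a proof-side caveat on the non-invertibility of the twist operator `R_χ`) · E-desc-21 SURVIVES (`x₂ = 4 ⇔
(II at 2 ∧ E[2] irreducible)` 26/26 with the converse at these levels). REF2: v7 §K⁷ (above). Beyond-print
theorem: NO for the laws (conjectures); YES for the finding (certified counterexample, not a route theorem).
PARTITION 0. Rows E-desc-19/20/21 of HOME `CANDIDATES.md`.

RENDERING: as `CongruenceExcessLaws.lean` (globally minimal `W`, datum at the conductor level, lattice clause +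
minimal-degree clause, `padicValNat`); the ceiling `⌈v/2⌉` is written `(v + 1) / 2` in `ℕ`.
-/

noncomputable section

open scoped MatrixGroups ModularForm

open CongruenceSubgroup WeierstrassCurve
  Literature.NumberTheory.EllipticCurves Literature.NumberTheory.EllipticCurves.ModularForms
  Literature.NumberTheory.DiophantineGeometry

namespace Summit.BirchSwinnertonDyer.Rank1Residual.ManinAdditive

/-- **Candidate E-desc-19 `CongruenceExcessCeiling`** (a CONJECTURE of the cell — the weakest
repair of ARS12 Conj. 2.2 consistent with census v1.1; nothing asserted).  Optimal `E`, any prime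
`p`: `v_p(r_E) ≤ v_p(m_E) + ⌈v_p(N)/2⌉` (written `(v + 1) / 2`).  Agrees with ARS for even
`v_p(N)`, hence for every `p ≥ 5`; at `v₂ = 7` it allows the observed `x₂ = 4`.
Census v1.1: 4555 / 4555 (N ≤ 2000 complete + 11 deeper levels); refuter-1 §R32: 78/78 at the four
violating levels. Edges (sibling file): `SharpCongruenceCeiling → CongruenceExcessCeiling`,
`AgasheRibetStein2012_conjecture → CongruenceExcessCeiling`.
[cite: AgasheRibetStein2012, Conj. 2.2 (the printed ceiling ⌊ord_p(N)/2⌋, refuted by the cell's 26 curves; the repaired ceiling ⌈ord_p(N)/2⌉ is NOT in print — cell bsd-f2-manin MEMO-desc.md §19.9, E-desc-19; refuter-2 v7 §K⁷)] -/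
@[conjecture] def CongruenceExcessCeiling : Prop :=
  ∀ (W : WeierstrassCurve ℚ) [W.IsElliptic] [W.IsGloballyMinimal] [NeZero (W.conductorNorm ℤ)]
    (D : ModularParametrizationData W (W.conductorNorm ℤ)),
    (∀ z ∈ D.L.lattice, ∃ w ∈ periodLattice D.f, z = D.c * w) →
    (∀ (W' : WeierstrassCurve ℚ) [W'.IsElliptic]
        (D' : ModularParametrizationData W' (W.conductorNorm ℤ)),
        D'.f = D.f → D.modularDegree ≤ D'.modularDegree) →
    ∀ (p : ℕ), p.Prime →
      padicValNat p (congruenceNumber D.f) ≤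
        padicValNat p D.modularDegree + (padicValNat p (W.conductorNorm ℤ) + 1) / 2

/-- **Candidate E-desc-19♯ `SharpCongruenceCeiling`** (data-sharp variant of E-desc-19; a CONJECTURE of
the cell; nothing asserted).  ARS12 Conj. 2.2 holds in every cell `(p, v_p(N)) ≠ (2, 7)` and at
`(2, 7)` the ceiling is `4` (attained by the `E[2]`-irreducible type-`II` classes at `N = 1664`, 2432,
3200, 3456; every other class there has `x₂ = 3 = ⌊7/2⌋` or less).  Since `v₂(N) ≤ 8` and
`v₃(N) ≤ 5` for elliptic curves over `ℚ`, this is the complete list of cells.  Census v1.1: 4555/4555.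
[cite: AgasheRibetStein2012, Conj. 2.2 (printed ceiling, kept off the cell (2,7); the value 4 at (2,7) is the cell's finding, NOT in print — MEMO-desc.md §19.9, E-desc-19♯)] -/
@[conjecture] def SharpCongruenceCeiling : Prop :=
  ∀ (W : WeierstrassCurve ℚ) [W.IsElliptic] [W.IsGloballyMinimal] [NeZero (W.conductorNorm ℤ)]
    (D : ModularParametrizationData W (W.conductorNorm ℤ)),
    (∀ z ∈ D.L.lattice, ∃ w ∈ periodLattice D.f, z = D.c * w) →
    (∀ (W' : WeierstrassCurve ℚ) [W'.IsElliptic]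
        (D' : ModularParametrizationData W' (W.conductorNorm ℤ)),
        D'.f = D.f → D.modularDegree ≤ D'.modularDegree) →
    ∀ (p : ℕ), p.Prime →
      padicValNat p (congruenceNumber D.f) ≤
        padicValNat p D.modularDegree +
          (if p = 2 ∧ padicValNat 2 (W.conductorNorm ℤ) = 7 then 4
           else padicValNat p (W.conductorNorm ℤ) / 2)

/-- **Candidate E-desc-20 `TwistPacketCongruenceInvariance`** (a CONJECTURE of the cell — the mechanism
behind the dyadic/ternary excess laws; nothing asserted).  If `W'` is an elliptic curve of the SAME
conductor as `W` and is isogenous to a quadratic twist of `W` (grammar of the cell's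
`TwistOrbitManinTransport`: `u • W.quadraticTwist d = C`, `C ~ W'`), then the congruence numbers of
their newforms agree: `r_E = r_{E'}` — the congruence number is constant on level-preserving twist
packets.  Census (desc g2, kit j290385 × congr-census-v1.1): 707 / 707 unordered pairs (d ∈ {−4, 8, −8}
at 16 ∣ N: 444 pairs, equality of the full r; d = −3 at 27 ∣ N: 269), N ≤ 2000 complete; refuter-1
§R32: χ₋₁-partner pairs 36/36 at the four F-desc-ARS levels (with a proof-side caveat: the twist operator
`R_χ` is not invertible on the integral Hecke module, so the law is not a formal consequence of twisting).
Combined with the an seat's degree identity along twists (E-an-16 / `OrbitDegreeManinIdentity`: the modular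
degree picks up one factor p exactly on the non-twist-minimal = starred member) it yields
`x_p(E') = x_p(E) − ([type(E') starred] − [type(E) starred])` on every packet (713 / 713 ordered
pairs), which is the common source of E-desc-14/15/16 and of the `N = 1664` excess `x₂ = 4` (type II)
next to `x₂ = 3` (its I₂* twists).
[cite: AgasheRibetStein2012, §2 (setting r_E, m_E only; the twist-packet invariance of r_E is NOT in print — MEMO-desc.md §19.9, E-desc-20; refuter-2 v7 §K⁷)] -/
@[conjecture] def TwistPacketCongruenceInvariance : Prop :=
  ∀ (W W' C : WeierstrassCurve ℚ) [W.IsElliptic] [W.IsGloballyMinimal] [W'.IsElliptic]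
    [W'.IsGloballyMinimal] [C.IsElliptic]
    [NeZero (W.conductorNorm ℤ)] [NeZero (W'.conductorNorm ℤ)] (u : VariableChange ℚ) (d : ℤ)
    (D : ModularParametrizationData W (W.conductorNorm ℤ))
    (D' : ModularParametrizationData W' (W'.conductorNorm ℤ)),
    W'.conductorNorm ℤ = W.conductorNorm ℤ →
    u • W.quadraticTwist ((d : ℤ) : ℚ) = C → WeierstrassCurve.IsIsogenous C W' →
    congruenceNumber D.f = congruenceNumber D'.f

/-- **Candidate E-desc-21 `DyadicTypeTwoExcessFour`** (a CONJECTURE of the cell; nothing asserted —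
every instance is a counterexample to ARS12 Conj. 2.2).  Optimal `E` with `v₂(N) = 7`, Kodaira type
`II` at `2` and `E[2]` irreducible ⇒ `v₂(r_E) = v₂(m_E) + 4` (one unit ABOVE the Agashe–Ribet–Stein
ceiling `⌊7/2⌋ = 3`).  Census (engine 1, kit j285284 / j290782 / j290784 / j290786; engine 1b certificate j289999
at 1664; refuter-1's third engine §R32, 26/26 to the digit): 26 / 26 classes — `1664 b1 f1 j1 o1` (r = 1536,
m = 96), `1664 i1 t1` (2560, 160), `2432 a1 c1` (2560, 160), `2432 e1 g1` (4608, 288), `3200 c1 s1` (7680, 96),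
`3200 l1 z1` (7680, 480), `3200 k1 w1` (53760, 3360), `3200 n1 bb1` (53760, 672), `3456 a1 e1` (4608, 96),
`3456 i1 n1` (4608, 288), `3456 j1 p1` (23040, 480), `3456 d1 g1` (23040, 1440); their `χ_{±8}`
twist partners (type `I₂*`, same r, m doubled) have `x₂ = 3` (26 / 26), and every other class with `v₂(N) = 7` in
the census has `x₂ ≤ 3` (types `II`/`III` reducible ≤ 3, `III` irreducible = 3 (3712 ×6), `III*` = 2, `I₂*`
irreducible = 3); refuter-1: on the four levels `x₂ = 4 ⇔ (II at 2 ∧ E[2] irreducible)`. The ecdata scan j290421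
lists 426 such classes at `N = 128·m`, `m` odd `< 400`. Edge (sibling file): with ONE witness datum in this regime
the law refutes the tree's `AgasheRibetStein2012_conjecture`.
[cite: AgasheRibetStein2012, Conj. 2.2 (the printed ceiling these curves violate; the law itself is NOT in print — MEMO-desc.md §19.9, E-desc-21; refuter-1 §R32, refuter-2 v7 §K⁷)] -/
@[conjecture] def DyadicTypeTwoExcessFour : Prop :=
  ∀ (W : WeierstrassCurve ℚ) [W.IsElliptic] [W.IsGloballyMinimal] [NeZero (W.conductorNorm ℤ)]
    (D : ModularParametrizationData W (W.conductorNorm ℤ)),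
    (∀ z ∈ D.L.lattice, ∃ w ∈ periodLattice D.f, z = D.c * w) →
    (∀ (W' : WeierstrassCurve ℚ) [W'.IsElliptic]
        (D' : ModularParametrizationData W' (W.conductorNorm ℤ)),
        D'.f = D.f → D.modularDegree ≤ D'.modularDegree) →
    padicValNat 2 (W.conductorNorm ℤ) = 7 →
      W.kodairaSymbolAt ((Rat.HeightOneSpectrum.primesEquiv (R := ℤ)).symm ⟨2, Nat.prime_two⟩) =
        KodairaSymbol.II →
      W.HasIrreducibleModPGaloisRep 2 →
      padicValNat 2 (congruenceNumber D.f) = padicValNat 2 D.modularDegree + 4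

end Summit.BirchSwinnertonDyer.Rank1Residual.ManinAdditive

end
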